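import Literature.NumberTheory.EllipticCurves.MordellCurveThreeDescentLocalRat
import Summits.BirchSwinnertonDyer.BirchSwinnertonDyer.Theorems.UniversalToricDescentTwinDecLocusCubeTest
import HarnessLib

set_option linter.dupNamespace false -- `Summit.BirchSwinnertonDyer.BirchSwinnertonDyer.Theorems.…` (summit = sub, D-0017)
set_option autoImplicit false

/-!
# Crux `HeegnerTwistCouplingInSupply` (stmt-BirchSwinnertonDyer-21381) — programme «TWISTED 3-ISOGENY DESCENT», file P1a:
# `3`-adic cubes `≡ ±1 (mod 9)` and the INTEGRAL `ℚ₃`-points of `y² = x³ + S²`, `S ∈ ℤ₃`, `S² ≡ 7 (mod 9)`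
# (the twisted Sylvester family `y² = x³ − 2p²`, `p ≡ 8 (mod 9)`, read `3`-adically with `S = p√−2`)

Route `BiquadraticEisensteinDescent` (cell `pub/bsd-wall`, width seat `bsd-wall-cm-bed-w4` g32; `--supports` 21381, helper).
The programme (memo `Cruxes/HeegnerTwistCouplingInSupply/TWISTED-DESCENT-PROGRAMME-w4g32.md`) discharges the `3`-descent
hypothesis `hDescU` of `…SylvesterCornerSqrtMinusTwo` for `W_p^{(−8)} ≅ y² = x³ − 2p²` (`p ≡ 17, 35 (mod 72)`) by a genuine
`3`-isogeny descent in the tree's cohomological currency; this file and its sequel `…SylvesterTwistThreeAdicImage` are the LOCAL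
INPUT AT THE PRIME `3` (on the `φ̂`-side the Kummer field is `K = ℚ(√−2)`, `3` splits, `K_𝔮 = ℚ₃`, and the partner curve is
`Y² = X³ + (27 p s)²`, `s = √−2 ∈ ℤ₃`; `S = p s` has `S² = −2p² ≡ 7 (mod 9)` as `p ≡ −1 (mod 9)`).

* §1 finite checks in `ℤ/9` (`decide`): `S² = 7 ⇒ 2S = ±1`; no `b² = a³ + 7` with `a` a unit; unit cubes are `±1`; …
* §2 cubes in `ℤ₃`: a `3`-adic integer `≡ ±1 (mod 9)` is a unit and a cube — REUSED from the tree
  (`UniversalToricDescentTwinDecLocusCubeTest.norm_eq_one_of_toZModPow_two` / `exists_cube_root_of_toZModPow_two`, Hensel at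
  precision `27`); here only the `ℚ₃`-form `exists_ne_zero_coe_eq_pow_three_of_toZModPow`;
* §3 under `S² ≡ 7 (mod 9)`: `S` is a unit, `2S` is a non-zero cube of `ℚ₃`;
* §4 ★ INTEGRAL POINTS: if `x, y ∈ ℤ₃`, `y² = x³ + S²`, then `3 ∣ x` (`norm_x_lt_one_of_integral`: unit cubes are `±1` and
  `±1 + 7` is not a square mod `9`) and `y + S` is `0` or a non-zero cube of `ℚ₃` (`exists_add_S_eq_cube_of_integral`:
  `(y + S)(y − S) = x³ ∈ 27ℤ₃` with `(y + S) − (y − S) = 2S` a unit, so the unit factor is `≡ ±2S ≡ ±1 (mod 9)`, a cube,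
  and the other factor is `x³` over it).

HONEST FRAMING: local lemmas of a support-layer programme on ONE CM family (measure zero in «all CM `W`»); the crux (residual
C⁺), its registered stubs, `hDescU` itself and BSD are untouched; nothing is closed by this file. THEOREMS ONLY (no `def`, no
named fact, no sorry). Supports stmt-BirchSwinnertonDyer-21381.
[cite: CohenPazuki2009, §4 (local images at p = 3)] [cite: SilvermanAEC2009, Prop. X.4.9 and Exercise 10.19]
-/

noncomputable section

open scoped Classical

open Polynomial

namespace Summit.BirchSwinnertonDyer.BirchSwinnertonDyer.Theorems.SylvesterTwistDescent

open Literature.NumberTheory.EllipticCurves Literature.NumberTheory.EllipticCurves.MordellDescent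
open Summit.BirchSwinnertonDyer.BirchSwinnertonDyer.Theorems.UniversalToricDescentTwinDecLocusCubeTest
  (norm_eq_one_of_toZModPow_two exists_cube_root_of_toZModPow_two zmod9_unit_cube)

/-! ## §1 Finite checks modulo `9` -/

section ModNine

/-- `S² ≡ 7 (mod 9)` forces `2S ≡ ±1 (mod 9)` (`S ≡ ±4`). [folklore] -/
theorem two_mul_eq_or_of_sq_eq_seven : ∀ s : ZMod (3 ^ 2), s ^ 2 = 7 → 2 * s = 1 ∨ 2 * s = -1 := by decide

/-- `S² ≡ 7 (mod 9)` forces `S` to be a unit mod `9` (`S · 4S = 4S² = 28 = 1`). [folklore] -/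
theorem mul_four_mul_eq_one_of_sq_eq_seven : ∀ s : ZMod (3 ^ 2), s ^ 2 = 7 → s * (4 * s) = 1 := by decide

/-- **No point with unit `x`-coordinate modulo `9`**: for a unit `a` (witnessed by `a c = 1`),
`b² ≠ a³ + 7` in `ℤ/9` (`a³ ∈ {±1}`, `a³ + 7 ∈ {8, 6}`, squares are `0, 1, 4, 7`). [folklore] -/
theorem no_unit_point_mod_nine : ∀ a b c : ZMod (3 ^ 2), a * c = 1 → b ^ 2 ≠ a ^ 3 + 7 := by decide

/-- A square which is `±1` modulo `9` is `1`, and its root is `±1`. [folklore] -/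
theorem eq_or_of_sq_eq_or : ∀ b : ZMod (3 ^ 2), (b ^ 2 = 1 ∨ b ^ 2 = -1) → b = 1 ∨ b = -1 := by decide

/-- An element of `3·(ℤ/9)` is not `±1`. [folklore] -/
theorem three_mul_ne_one_and : ∀ c : ZMod (3 ^ 2), 3 * c ≠ 1 ∧ 3 * c ≠ -1 := by decide

/-- `3^n = 0` in `ℤ/9` for `n ≥ 2`. [folklore] -/
theorem three_pow_eq_zero_zmod_nine {n : ℕ} (hn : 2 ≤ n) : ((3 : ℕ) : ZMod (3 ^ 2)) ^ n = 0 := by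
  obtain ⟨k, rfl⟩ := Nat.exists_eq_add_of_le hn
  rw [pow_add]
  have : ((3 : ℕ) : ZMod (3 ^ 2)) ^ 2 = 0 := by decide
  rw [this, zero_mul]

end ModNine

/-! ## §2 Cubes in `ℤ₃`: elements `≡ ±1 (mod 9)` -/

section ThreeAdicCubes

/-- The residue mod `9` of a `3`-adic integer of norm `< 1` is a multiple of `3`. [folklore] -/
theorem exists_toZModPow_two_eq_three_mul {x : ℤ_[3]} (hx : ‖x‖ < 1) :
    ∃ c : ZMod (3 ^ 2), PadicInt.toZModPow 2 x = 3 * c := by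
  obtain ⟨y, rfl⟩ := (PadicInt.norm_lt_one_iff_dvd x).mp hx
  refine ⟨PadicInt.toZModPow 2 y, ?_⟩
  rw [map_mul, map_natCast, Nat.cast_ofNat]

/-- The `ℚ₃`-form: a `3`-adic integer `≡ ±1 (mod 9)` is a NON-ZERO cube of `ℚ₃`. [folklore] -/
theorem exists_ne_zero_coe_eq_pow_three_of_toZModPow {x : ℤ_[3]}
    (hx : PadicInt.toZModPow 2 x = 1 ∨ PadicInt.toZModPow 2 x = -1) :
    ∃ w : ℚ_[3], w ≠ 0 ∧ (x : ℚ_[3]) = w ^ 3 := by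
  obtain ⟨z, hz⟩ := exists_cube_root_of_toZModPow_two hx
  refine ⟨z, ?_, by rw [← hz, PadicInt.coe_pow]⟩
  intro h0
  rw [PadicInt.coe_eq_zero] at h0
  rw [h0, zero_pow three_ne_zero] at hz
  have h1 := norm_eq_one_of_toZModPow_two hx
  rw [← hz, norm_zero] at h1
  exact zero_ne_one h1

end ThreeAdicCubes

/-- Norms in `ℚ₃` are powers of `3`: `‖x‖ = 3^{−v(x)}`; equal norms of powers give a relation of valuations.
[folklore] -/
theorem two_mul_valuation_eq_of_sq_eq {x y : ℚ_[3]} (hx : x ≠ 0) (hy : y ≠ 0) (h : ‖y‖ ^ 2 = ‖x‖ ^ 3) :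
    2 * y.valuation = 3 * x.valuation := by
  rw [Padic.norm_eq_zpow_neg_valuation hx, Padic.norm_eq_zpow_neg_valuation hy, ← zpow_natCast, ← zpow_natCast,
    ← zpow_mul, ← zpow_mul] at h
  have h3 : (1 : ℝ) < ((3 : ℕ) : ℝ) := by norm_num
  have := zpow_right_injective₀ (by positivity) h3.ne' h
  push_cast at this
  linarith

/-! ## §3 The hypothesis `S² ≡ 7 (mod 9)`: units, `2S` is a cube -/

section Hyp

variable {S : ℤ_[3]} (hS : PadicInt.toZModPow 2 (S ^ 2) = 7)
include hS

/-- `S` is a `3`-adic unit. [folklore] -/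
theorem norm_S_eq_one : ‖S‖ = 1 := by
  rcases (PadicInt.norm_le_one S).lt_or_eq with hlt | h
  · exfalso
    obtain ⟨c, hc⟩ := exists_toZModPow_two_eq_three_mul hlt
    rw [map_pow, hc] at hS
    have h90 : ((3 : ZMod (3 ^ 2)) * c) ^ 2 = 0 := by
      rw [mul_pow, show (3 : ZMod (3 ^ 2)) ^ 2 = 0 by decide, zero_mul]
    rw [h90] at hS
    exact absurd hS (by decide)
  · exact h

/-- `S ≠ 0` in `ℚ₃`. [folklore] -/
theorem coe_S_ne_zero : (S : ℚ_[3]) ≠ 0 := by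
  intro h
  rw [PadicInt.coe_eq_zero] at h
  have := norm_S_eq_one hS
  rw [h, norm_zero] at this
  exact zero_ne_one this

/-- `2S ≡ ±1 (mod 9)`. [folklore] -/
theorem toZModPow_two_mul_S :
    PadicInt.toZModPow 2 (2 * S) = 1 ∨ PadicInt.toZModPow 2 (2 * S) = -1 := by
  rw [map_mul, map_ofNat]
  exact two_mul_eq_or_of_sq_eq_seven _ (by rw [← map_pow]; exact hS)

/-- **`2S` is a non-zero cube of `ℚ₃`.** [folklore] -/
theorem exists_two_mul_S_eq_cube : ∃ w : ℚ_[3], w ≠ 0 ∧ 2 * (S : ℚ_[3]) = w ^ 3 := by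
  obtain ⟨w, hw0, hw⟩ := exists_ne_zero_coe_eq_pow_three_of_toZModPow (toZModPow_two_mul_S hS)
  refine ⟨w, hw0, ?_⟩
  rw [← hw, PadicInt.coe_mul, padicInt_coe_ofNat]

/-- The same hypothesis holds for `−S`. [folklore] -/
theorem hyp_neg : PadicInt.toZModPow 2 ((-S) ^ 2) = 7 := by rw [neg_sq]; exact hS

/-! ## §4 Integral points: `x ∈ ℤ₃` -/

/-- **No `3`-adically integral point has unit `x`-coordinate**: if `x, y ∈ ℤ₃`, `y² = x³ + S²`, then `3 ∣ x`.
(Reduce mod `9`: unit cubes are `±1` and `±1 + 7` is not a square.) [cite: CohenPazuki2009, §4] -/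
theorem norm_x_lt_one_of_integral {x y : ℤ_[3]} (h : y ^ 2 = x ^ 3 + S ^ 2) : ‖x‖ < 1 := by
  rcases (PadicInt.norm_le_one x).lt_or_eq with hlt | hx
  · exact hlt
  · exfalso
    have hu : IsUnit x := PadicInt.isUnit_iff.mpr hx
    obtain ⟨c, hc⟩ := hu.exists_right_inv
    have h9 := congrArg (PadicInt.toZModPow 2) h
    rw [map_pow, map_add, map_pow, hS] at h9
    have hc9 := congrArg (PadicInt.toZModPow 2) hc
    rw [map_mul, map_one] at hc9
    exact no_unit_point_mod_nine _ _ _ hc9 h9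

/-- **Integral points: `y + S` is zero or a non-zero cube of `ℚ₃`.** For `x, y ∈ ℤ₃` with `y² = x³ + S²`
(so `3 ∣ x`): `(y + S)(y − S) = x³ ∈ 27ℤ₃` with `(y + S) − (y − S) = 2S` a unit; whichever factor is a unit is
`≡ ±2S ≡ ±1 (mod 9)`, a cube, and the other is `x³` over it. [cite: CohenPazuki2009, §4] -/
theorem exists_add_S_eq_cube_of_integral {x y : ℤ_[3]} (h : y ^ 2 = x ^ 3 + S ^ 2)
    (hne : (y : ℚ_[3]) + S ≠ 0) : ∃ w : ℚ_[3], w ≠ 0 ∧ (y : ℚ_[3]) + S = w ^ 3 := by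
  have hS1 := norm_S_eq_one hS
  obtain ⟨x₁, rfl⟩ := (PadicInt.norm_lt_one_iff_dvd x).mp (norm_x_lt_one_of_integral hS h)
  have hprod : (y + S) * (y - S) = 27 * x₁ ^ 3 := by
    have : (y + S) * (y - S) = y ^ 2 - S ^ 2 := by ring
    rw [this, h]; push_cast; ring
  rcases (PadicInt.norm_le_one (y + S)).lt_or_eq with hlt | hunit
  · /- `3 ∣ y + S`: then `y − S` is a unit `≡ −2S (mod 9)`, a cube `z³`, and `y + S = (3x₁/z)³` -/
    have hunit' : ‖y - S‖ = 1 := by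
      rcases (PadicInt.norm_le_one (y - S)).lt_or_eq with hlt' | h'
      · exfalso
        -- `3 ∣ (y + S) − (y − S) = 2S`, contradicting `‖2S‖ = 1`
        have h2S : ‖(2 : ℤ_[3]) * S‖ < 1 := by
          have : (2 : ℤ_[3]) * S = (y + S) - (y - S) := by ring
          rw [this, sub_eq_add_neg]
          refine lt_of_le_of_lt (PadicInt.nonarchimedean _ _) (max_lt hlt ?_)
          rwa [norm_neg]
        have h2 : ‖(2 : ℤ_[3])‖ = 1 := by
          have hle : ‖((2 : ℤ) : ℤ_[3])‖ ≤ 1 := PadicInt.norm_le_one _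
          have hnlt : ¬ ‖((2 : ℤ) : ℤ_[3])‖ < 1 := by
            rw [PadicInt.norm_int_lt_one_iff_dvd]; decide
          push_cast at hle hnlt
          linarith [hle, not_lt.mp hnlt]
        rw [norm_mul, h2, hS1, one_mul] at h2S
        exact lt_irrefl _ h2S
      · exact h'
    obtain ⟨u, hu⟩ := (PadicInt.isUnit_iff.mpr hunit').exists_left_inv
    -- `y + S ≡ 0 (mod 9)`: `y + S = u · 27 x₁³`
    have hyS : y + S = u * (27 * x₁ ^ 3) := by
      calc y + S = u * (y - S) * (y + S) := by rw [hu, one_mul]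
        _ = u * ((y + S) * (y - S)) := by ring
        _ = u * (27 * x₁ ^ 3) := by rw [hprod]
    have h9 : PadicInt.toZModPow 2 (y + S) = 0 := by
      rw [hyS, map_mul, map_mul, show (27 : ℤ_[3]) = ((27 : ℕ) : ℤ_[3]) by norm_cast, map_natCast,
        show ((27 : ℕ) : ZMod (3 ^ 2)) = 0 by decide, zero_mul, mul_zero]
    have hmod : PadicInt.toZModPow 2 (y - S) = 1 ∨ PadicInt.toZModPow 2 (y - S) = -1 := by
      have : y - S = (y + S) + -(2 * S) := by ring
      rw [this, map_add, h9, zero_add, map_neg]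
      rcases toZModPow_two_mul_S hS with h1 | h1 <;> rw [h1]
      · right; rfl
      · left; rw [neg_neg]
    obtain ⟨z, hz⟩ := exists_cube_root_of_toZModPow_two hmod
    have hz0 : (z : ℚ_[3]) ≠ 0 := by
      intro h0
      rw [PadicInt.coe_eq_zero] at h0
      rw [h0, zero_pow three_ne_zero] at hz
      rw [← hz, norm_zero] at hunit'
      exact zero_ne_one hunit'
    refine ⟨3 * (x₁ : ℚ_[3]) / z, ?_, ?_⟩
    · intro h0
      apply hne
      -- `w = 0` forces `x₁ = 0`, hence `y + S = 0`
      rcases div_eq_zero_iff.mp h0 with h1 | h1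
      · have hx1 : (x₁ : ℚ_[3]) = 0 := by
          rcases mul_eq_zero.mp h1 with h2 | h2
          · norm_num at h2
          · exact h2
        have := congrArg ((↑) : ℤ_[3] → ℚ_[3]) hyS
        push_cast at this
        rw [this, hx1]; ring
      · exact absurd h1 hz0
    · have hprodQ := congrArg ((↑) : ℤ_[3] → ℚ_[3]) hprod
      have hzQ := congrArg ((↑) : ℤ_[3] → ℚ_[3]) hz
      push_cast at hprodQ hzQ
      rw [padicInt_coe_ofNat] at hprodQ
      rw [div_pow, eq_div_iff (pow_ne_zero 3 hz0), hzQ]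
      linear_combination hprodQ
  · /- `y + S` a unit: `y − S = u·27x₁³ ≡ 0`, so `y + S ≡ 2S ≡ ±1 (mod 9)` is a cube -/
    obtain ⟨u, hu⟩ := (PadicInt.isUnit_iff.mpr hunit).exists_left_inv
    have hyS : y - S = u * (27 * x₁ ^ 3) := by
      calc y - S = u * (y + S) * (y - S) := by rw [hu, one_mul]
        _ = u * ((y + S) * (y - S)) := by ring
        _ = u * (27 * x₁ ^ 3) := by rw [hprod]
    have h9 : PadicInt.toZModPow 2 (y - S) = 0 := by
      rw [hyS, map_mul, map_mul, show (27 : ℤ_[3]) = ((27 : ℕ) : ℤ_[3]) by norm_cast, map_natCast,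
        show ((27 : ℕ) : ZMod (3 ^ 2)) = 0 by decide, zero_mul, mul_zero]
    have hmod : PadicInt.toZModPow 2 (y + S) = 1 ∨ PadicInt.toZModPow 2 (y + S) = -1 := by
      have : y + S = (y - S) + 2 * S := by ring
      rw [this, map_add, h9, zero_add]
      exact toZModPow_two_mul_S hS
    obtain ⟨w, hw0, hw⟩ := exists_ne_zero_coe_eq_pow_three_of_toZModPow hmod
    exact ⟨w, hw0, by rw [← hw]; push_cast; ring⟩

end Hyp

end Summit.BirchSwinnertonDyer.BirchSwinnertonDyer.Theorems.SylvesterTwistDescent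

end
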